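import Mathlib
import Literature.Probability.Percolation.Percolation
import Literature.Probability.Percolation.DiagonalStripColumns
import Literature.Probability.Percolation.DiagonalColumnPatterns
import Literature.Probability.Percolation.DiagonalStripPlanarity
import HarnessLib

/-!
# Temperley–Lieb moves on column patterns and the local relations of the layer update

Topic `Literature/Probability/Percolation`. Tools for the interlacing relation (Ikhlef–Ponsaing,
J. Stat. Phys. 149 (2012), arXiv:1202.5476, Lemma 3.2) of the inhomogeneous transfer matrix in
the cluster language (`DiagonalStripTransferInhomogeneous.lean`): the Temperley–Lieb generator at
level `i` acts on column patterns as `cpIsolate` (level `i` hosts a site of the column) or `cpJoin`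
(level `i` is a dual site between two consecutive sites), flags included; and the layer update
`colUpdate` with the two edges at the site of level `i` prescribed satisfies the LOCAL RELATIONS
used to push `Ř_i` through a row (IP12 Lemma 3.2, proof via the Yang–Baxter equation):

* `cpJoin`, `cpIsolate` (with `_fst_eq_true_iff`, `_snd_eq_true_iff`);
* closure tools: `colUpdate_ext` (the update only depends on the closure of the update relation
  and the closure-saturation of the wall contacts), `eqvGen_attach_isolated` (attaching an isolated
  point `j` to `a` = pulling the closure back along `j ↦ a`), `eqvGen_insert_iff_mergeRel` (adding one
  pair to the generators = `mergeRel` of the closure), `mergeRel_congr_left/right`;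
* `patternOf ρ W` (`colUpdate = patternOf (closure) (wall contacts)`, `colUpdate_eq_patternOf`) and
  `cpIsolate_patternOf_pullback` (isolating a new site in a pattern read off a pull-back closure);
* `setEdge`, `IsBridgeSite E uL uR j` (the new site `j` has old neighbours `uL ≠ uR` and NO edge in `E`),
  `bridgeSiteEdges E uL uR j bL bR` (prescribe the two edges at `j`), `bridgeEdges_apply`,
  `eqvGen_updRel_bridgeEdges_iff`, `eqvGen_updRel_cpJoin_iff`, and the CASE (I) LOCAL RELATIONS
  (writing `M_ε` for the update with the bridge edges `ε ∈ {o,c}²`):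
  **`colUpdate_cpJoin_bridge`** (`M_ε ∘ join_{uL uR} = M_oo` for `ε ≠ cc`),
  **`cpIsolate_colUpdate_bridge_open_open`** (`iso_j ∘ M_oo = M_cc ∘ join_{uL uR}`),
  **`cpIsolate_colUpdate_bridge_not_both`** (`iso_j ∘ M_ε = M_cc` for `ε ≠ oo`),
  `bridgeEdges_false_false` (`M_cc` is the update of the layer itself).

These are exactly the operator relations behind the Yang–Baxter push of `Ř_i` through a row at a
level `i` hosting a NEW site; case (II) (level `i` hosts an OLD site) and the scalar identities of
the tile weights are for a sequel.

## References

* Y. Ikhlef, A. K. Ponsaing, J. Stat. Phys. 149 (2012) 10–36, arXiv:1202.5476, §3.1, Lemma 3.2.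
  [IkhlefPonsaing2012]
-/

namespace Literature.Probability.Percolation

open Relation

variable {m : ℕ}

/-! ### The Temperley–Lieb moves on column patterns -/

/-- **Join** the classes of the column sites `a, b` (flags follow). [cite: IkhlefPonsaing2012, §3.1] -/
def cpJoin (a b : Fin (m + 1)) (P : ColPattern m) : ColPattern m :=
  (fun i j => P.1 i j || (P.1 i a && P.1 b j) || (P.1 i b && P.1 a j),
    fun i => P.2 i || (P.1 i a && P.2 b) || (P.1 i b && P.2 a))

/-- **Isolate** the column site `a`: it becomes an unflagged singleton. [cite: IkhlefPonsaing2012, §3.1] -/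
def cpIsolate (a : Fin (m + 1)) (P : ColPattern m) : ColPattern m :=
  (fun i j => decide (i = j) || (!decide (i = a) && !decide (j = a) && P.1 i j),
    fun i => !decide (i = a) && P.2 i)

/-- Unfolding of `cpJoin` (relation part). [folklore] -/
theorem cpJoin_fst_eq_true_iff (a b : Fin (m + 1)) (P : ColPattern m) (i j : Fin (m + 1)) :
    (cpJoin a b P).1 i j = true ↔
      P.1 i j = true ∨ (P.1 i a = true ∧ P.1 b j = true) ∨ (P.1 i b = true ∧ P.1 a j = true) := by
  simp only [cpJoin, Bool.or_eq_true, Bool.and_eq_true, or_assoc]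

/-- Unfolding of `cpJoin` (flag part). [folklore] -/
theorem cpJoin_snd_eq_true_iff (a b : Fin (m + 1)) (P : ColPattern m) (i : Fin (m + 1)) :
    (cpJoin a b P).2 i = true ↔
      P.2 i = true ∨ (P.1 i a = true ∧ P.2 b = true) ∨ (P.1 i b = true ∧ P.2 a = true) := by
  simp only [cpJoin, Bool.or_eq_true, Bool.and_eq_true, or_assoc]

/-- Unfolding of `cpIsolate` (relation part). [folklore] -/
theorem cpIsolate_fst_eq_true_iff (a : Fin (m + 1)) (P : ColPattern m) (i j : Fin (m + 1)) :
    (cpIsolate a P).1 i j = true ↔ i = j ∨ (i ≠ a ∧ j ≠ a ∧ P.1 i j = true) := by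
  simp only [cpIsolate, Bool.or_eq_true, decide_eq_true_eq, Bool.and_eq_true, Bool.not_eq_true',
    decide_eq_false_iff_not, and_assoc]

/-- Unfolding of `cpIsolate` (flag part). [folklore] -/
theorem cpIsolate_snd_eq_true_iff (a : Fin (m + 1)) (P : ColPattern m) (i : Fin (m + 1)) :
    (cpIsolate a P).2 i = true ↔ i ≠ a ∧ P.2 i = true := by
  simp only [cpIsolate, Bool.and_eq_true, Bool.not_eq_true', decide_eq_false_iff_not]

/-! ### Closure tools -/

section Closure

variable {V : Type*}

/-- `EqvGen r ≤ EqvGen s` as soon as `r ≤ EqvGen s`. [folklore] -/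
theorem eqvGen_le_eqvGen {r s : V → V → Prop} (h : ∀ x y, r x y → EqvGen s x y) (x y : V)
    (hxy : EqvGen r x y) : EqvGen s x y :=
  (EqvGen.is_equivalence s).eqvGen_iff.1 (EqvGen.mono h x y hxy)

/-- Two generating relations have the same closure iff each is below the closure of the other. [folklore] -/
theorem eqvGen_iff_eqvGen {r s : V → V → Prop} (h : ∀ x y, r x y → EqvGen s x y)
    (h' : ∀ x y, s x y → EqvGen r x y) (x y : V) : EqvGen r x y ↔ EqvGen s x y :=
  ⟨eqvGen_le_eqvGen h x y, eqvGen_le_eqvGen h' x y⟩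

/-- **Attaching an isolated point.** If no generator touches `j`, the closure of `r` plus the pair
`(a, j)` is the pull-back of the closure of `r` along `j ↦ a`. [folklore] -/
theorem eqvGen_attach_isolated [DecidableEq V] {r : V → V → Prop} (a : V) {j : V}
    (hj : ∀ y, ¬ r j y ∧ ¬ r y j) (x y : V) :
    EqvGen (fun x y => r x y ∨ (x = a ∧ y = j)) x y ↔
      EqvGen r (if x = j then a else x) (if y = j then a else y) := by
  set π : V → V := fun x => if x = j then a else x with hπ
  have hπa : π a = a := by simp [hπ]
  have hπj : π j = a := by simp [hπ]
  have hπr : ∀ x y, r x y → π x = x ∧ π y = y := by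
    intro x y h
    constructor
    · simp only [hπ]; rw [if_neg]; rintro rfl; exact (hj y).1 h
    · simp only [hπ]; rw [if_neg]; rintro rfl; exact (hj x).2 h
  show _ ↔ EqvGen r (π x) (π y)
  constructor
  · intro h
    induction h with
    | rel x y h =>
      rcases h with h | ⟨rfl, rfl⟩
      · obtain ⟨hx, hy⟩ := hπr x y h
        rw [hx, hy]; exact EqvGen.rel _ _ h
      · rw [hπa, hπj]; exact EqvGen.refl _
    | refl x => exact EqvGen.refl _
    | symm x y _ ih => exact EqvGen.symm _ _ ih
    | trans x y z _ _ ih1 ih2 => exact EqvGen.trans _ _ _ ih1 ih2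
  · intro h
    have h1 : EqvGen (fun x y => r x y ∨ (x = a ∧ y = j)) (π x) (π y) :=
      EqvGen.mono (fun x y h => Or.inl h) _ _ h
    have hx : ∀ x, EqvGen (fun x y => r x y ∨ (x = a ∧ y = j)) x (π x) := by
      intro x
      by_cases hxj : x = j
      · subst hxj; rw [hπj]; exact EqvGen.symm _ _ (EqvGen.rel _ _ (Or.inr ⟨rfl, rfl⟩))
      · have : π x = x := by simp [hπ, hxj]
        rw [this]; exact EqvGen.refl _
    exact EqvGen.trans _ _ _ (hx x) (EqvGen.trans _ _ _ h1 (EqvGen.symm _ _ (hx y)))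

/-- **Adding one pair to the generators is `mergeRel` of the closure.** [folklore] -/
theorem eqvGen_insert_iff_mergeRel {r : V → V → Prop} (a b x y : V) :
    EqvGen (fun x y => r x y ∨ (x = a ∧ y = b)) x y ↔ mergeRel (EqvGen r) a b x y := by
  have hE := EqvGen.is_equivalence r
  have hM := mergeRel_equivalence hE a b
  constructor
  · intro h
    refine (hM.eqvGen_iff).1 (EqvGen.mono (fun x y h => ?_) _ _ h)
    rcases h with h | ⟨rfl, rfl⟩
    · exact mergeRel_of_rel (EqvGen.rel _ _ h)
    · exact mergeRel_self hE _ _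
  · have hle : ∀ x y, EqvGen r x y → EqvGen (fun x y => r x y ∨ (x = a ∧ y = b)) x y :=
      fun x y h => EqvGen.mono (fun x y h => Or.inl h) _ _ h
    have hab : EqvGen (fun x y => r x y ∨ (x = a ∧ y = b)) a b := EqvGen.rel _ _ (Or.inr ⟨rfl, rfl⟩)
    rintro (h | ⟨h1, h2⟩ | ⟨h1, h2⟩)
    · exact hle _ _ h
    · exact EqvGen.trans _ _ _ (hle _ _ h1) (EqvGen.trans _ _ _ hab (hle _ _ h2))
    · exact EqvGen.trans _ _ _ (hle _ _ h1) (EqvGen.trans _ _ _ (EqvGen.symm _ _ hab) (hle _ _ h2))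

/-- `mergeRel` only depends on the classes of the merged elements (left). [folklore] -/
theorem mergeRel_congr_left {S : V → V → Prop} (hS : Equivalence S) {a a' : V} (h : S a a') (b : V) :
    mergeRel S a b = mergeRel S a' b := by
  funext x y; apply propext
  constructor
  · rintro (hxy | ⟨h1, h2⟩ | ⟨h1, h2⟩)
    · exact Or.inl hxy
    · exact Or.inr (Or.inl ⟨hS.trans h1 h, h2⟩)
    · exact Or.inr (Or.inr ⟨h1, hS.trans (hS.symm h) h2⟩)
  · rintro (hxy | ⟨h1, h2⟩ | ⟨h1, h2⟩)
    · exact Or.inl hxy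
    · exact Or.inr (Or.inl ⟨hS.trans h1 (hS.symm h), h2⟩)
    · exact Or.inr (Or.inr ⟨h1, hS.trans h h2⟩)

/-- `mergeRel` only depends on the classes of the merged elements (right). [folklore] -/
theorem mergeRel_congr_right {S : V → V → Prop} (hS : Equivalence S) (a : V) {b b' : V} (h : S b b') :
    mergeRel S a b = mergeRel S a b' := by
  rw [mergeRel_comm S a b, mergeRel_congr_left hS h a, mergeRel_comm]

end Closure

/-! ### The update only sees the closure -/

/-- **Extensionality of the update**: if two (pattern, edge layer) pairs generate the same closure on
old ⊔ new sites and their wall contacts are mutually reachable inside it, the updates agree. [folklore] -/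
theorem colUpdate_ext {c : ℤ} {P P' : ColPattern m} {E E' : Fin (m + 1) → Fin (m + 1) → Bool}
    (hrel : ∀ x y, EqvGen (updRel m P E) x y ↔ EqvGen (updRel m P' E') x y)
    (hwall : ∀ z, updWall m c P z → ∃ z', EqvGen (updRel m P' E') z z' ∧ updWall m c P' z')
    (hwall' : ∀ z, updWall m c P' z → ∃ z', EqvGen (updRel m P E) z z' ∧ updWall m c P z') :
    colUpdate m c P E = colUpdate m c P' E' := by
  classical
  refine Prod.ext (funext fun j => funext fun j' => ?_) (funext fun j => ?_)
  · simp only [colUpdate]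
    rw [decide_eq_decide]
    exact hrel _ _
  · simp only [colUpdate]
    rw [decide_eq_decide]
    constructor
    · rintro ⟨z, hz, hw⟩
      obtain ⟨z', hzz', hw'⟩ := hwall z hw
      exact ⟨z', EqvGen.trans _ _ _ ((hrel _ _).1 hz) hzz', hw'⟩
    · rintro ⟨z, hz, hw⟩
      obtain ⟨z', hzz', hw'⟩ := hwall' z hw
      exact ⟨z', EqvGen.trans _ _ _ ((hrel _ _).2 hz) hzz', hw'⟩

/-! ### Prescribing the two edges at a new site -/

/-- Set the cross edge `(i, j)` of an edge layer to `b`. [folklore] -/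
def setEdge (E : Fin (m + 1) → Fin (m + 1) → Bool) (i j : Fin (m + 1)) (b : Bool) :
    Fin (m + 1) → Fin (m + 1) → Bool :=
  fun i' j' => if i' = i ∧ j' = j then b else E i' j'

/-- The prescribed edge. [folklore] -/
@[simp] theorem setEdge_same (E : Fin (m + 1) → Fin (m + 1) → Bool) (i j : Fin (m + 1)) (b : Bool) :
    setEdge E i j b i j = b := by simp [setEdge]

/-- The other edges are unchanged. [folklore] -/
theorem setEdge_of_ne (E : Fin (m + 1) → Fin (m + 1) → Bool) {i j i' j' : Fin (m + 1)} (b : Bool)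
    (h : ¬ (i' = i ∧ j' = j)) : setEdge E i j b i' j' = E i' j' := by simp [setEdge, h]

/-- **A bridge site**: the new site `j` has the two old neighbours `uL ≠ uR`, and the layer `E` has
NO edge at `j` (the two edges at `j` are prescribed separately by `setEdge`). [folklore] -/
structure IsBridgeSite (E : Fin (m + 1) → Fin (m + 1) → Bool) (uL uR j : Fin (m + 1)) : Prop where
  ne : uL ≠ uR
  noEdge : ∀ i, E i j = false

/-- The layer with the two edges at `j` set to `bL, bR`. [folklore] -/
def bridgeSiteEdges (E : Fin (m + 1) → Fin (m + 1) → Bool) (uL uR j : Fin (m + 1)) (bL bR : Bool) :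
    Fin (m + 1) → Fin (m + 1) → Bool :=
  setEdge (setEdge E uL j bL) uR j bR

/-- The edges of the bridge layer. [folklore] -/
theorem bridgeEdges_apply {E : Fin (m + 1) → Fin (m + 1) → Bool} {uL uR j : Fin (m + 1)}
    (hB : IsBridgeSite E uL uR j) (bL bR : Bool) (i j' : Fin (m + 1)) :
    bridgeSiteEdges E uL uR j bL bR i j' = true ↔
      (j' ≠ j ∧ E i j' = true) ∨ (i = uL ∧ j' = j ∧ bL = true) ∨ (i = uR ∧ j' = j ∧ bR = true) := by
  unfold bridgeSiteEdges setEdge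
  by_cases h1 : i = uR ∧ j' = j
  · obtain ⟨rfl, rfl⟩ := h1
    simp [hB.ne.symm]
  · rw [if_neg h1]
    by_cases h2 : i = uL ∧ j' = j
    · obtain ⟨rfl, rfl⟩ := h2
      simp [hB.ne]
    · rw [if_neg h2]
      by_cases hj : j' = j
      · subst hj
        have hi1 : i ≠ uR := fun h => h1 ⟨h, rfl⟩
        have hi2 : i ≠ uL := fun h => h2 ⟨h, rfl⟩
        simp [hB.noEdge i, hi1, hi2]
      · simp [hj]

/-- An isolated point is a singleton class of the closure. [folklore] -/
theorem eqvGen_isolated_iff {V : Type*} {r : V → V → Prop} {j : V} (hj : ∀ y, ¬ r j y ∧ ¬ r y j)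
    (y : V) : EqvGen r j y ↔ y = j := by
  constructor
  · suffices H : ∀ a b, EqvGen r a b → (a = j ↔ b = j) from fun h => ((H _ _ h).1 rfl).symm ▸ rfl
    intro a b hab
    induction hab with
    | rel a b h =>
      constructor
      · rintro rfl; exact absurd h (hj b).1
      · rintro rfl; exact absurd h (hj a).2
    | refl a => exact Iff.rfl
    | symm a b _ ih => exact ih.symm
    | trans a b c _ _ ih1 ih2 => exact ih1.trans ih2
  · rintro rfl; exact EqvGen.refl _

/-! ### Patterns read off a closure -/

section PatternOf

open Classical in
/-- The pattern read off a relation `ρ` on old ⊔ new sites and a wall predicate `W`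
(`colUpdate m c P E = patternOf (EqvGen (updRel m P E)) (updWall m c P)`). [folklore] -/
noncomputable def patternOf (ρ : Fin (m + 1) ⊕ Fin (m + 1) → Fin (m + 1) ⊕ Fin (m + 1) → Prop)
    (W : Fin (m + 1) ⊕ Fin (m + 1) → Prop) : ColPattern m :=
  (fun x y => decide (ρ (Sum.inr x) (Sum.inr y)), fun x => decide (∃ z, ρ (Sum.inr x) z ∧ W z))

/-- The update is the pattern read off the closure of the update relation. [folklore] -/
theorem colUpdate_eq_patternOf (c : ℤ) (P : ColPattern m) (E : Fin (m + 1) → Fin (m + 1) → Bool) :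
    colUpdate m c P E = patternOf (EqvGen (updRel m P E)) (updWall m c P) := rfl

/-- **Isolating the new site `j` in a pattern read off a pull-back closure.** If `ρ'` is the
pull-back of the equivalence `ρ` along `inr j ↦ t`, `inr j` is a singleton class of `ρ` and not a
wall contact, and the wall predicates `W, W'` are mutually reachable inside `ρ`, then
`cpIsolate j (patternOf ρ' W) = patternOf ρ W'`. [folklore] -/
theorem cpIsolate_patternOf_pullback {ρ ρ' : Fin (m + 1) ⊕ Fin (m + 1) → Fin (m + 1) ⊕ Fin (m + 1) → Prop}
    {W W' : Fin (m + 1) ⊕ Fin (m + 1) → Prop} (hρ : Equivalence ρ) {j : Fin (m + 1)}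
    {t : Fin (m + 1) ⊕ Fin (m + 1)}
    (hpull : ∀ x y, ρ' x y ↔ ρ (if x = Sum.inr j then t else x) (if y = Sum.inr j then t else y))
    (hsingle : ∀ y, ρ (Sum.inr j) y → y = Sum.inr j) (hWj : ¬ W (Sum.inr j)) (hW'j : ¬ W' (Sum.inr j))
    (hWW' : ∀ z, W z → ∃ z', ρ z z' ∧ W' z') (hW'W : ∀ z, W' z → ∃ z', ρ z z' ∧ W z') :
    cpIsolate j (patternOf ρ' W) = patternOf ρ W' := by
  classical
  refine Prod.ext (funext fun x => funext fun y => ?_) (funext fun x => ?_)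
  · rw [Bool.eq_iff_iff, cpIsolate_fst_eq_true_iff]
    simp only [patternOf, decide_eq_true_eq]
    constructor
    · rintro (rfl | ⟨hx, hy, h⟩)
      · exact hρ.refl _
      · rw [hpull] at h
        rwa [if_neg (by simpa using hx), if_neg (by simpa using hy)] at h
    · intro h
      by_cases hx : x = j
      · subst hx
        exact Or.inl (Sum.inr_injective (hsingle _ h)).symm
      by_cases hy : y = j
      · subst hy
        exact absurd (Sum.inr_injective (hsingle _ (hρ.symm h))) hx
      refine Or.inr ⟨hx, hy, ?_⟩
      rw [hpull, if_neg (by simpa using hx), if_neg (by simpa using hy)]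
      exact h
  · rw [Bool.eq_iff_iff, cpIsolate_snd_eq_true_iff]
    simp only [patternOf, decide_eq_true_eq]
    constructor
    · rintro ⟨hx, z, hxz, hz⟩
      rw [hpull, if_neg (by simpa using hx)] at hxz
      have hzj : z ≠ Sum.inr j := by rintro rfl; exact hWj hz
      rw [if_neg hzj] at hxz
      obtain ⟨z', hzz', hz'⟩ := hWW' z hz
      exact ⟨z', hρ.trans hxz hzz', hz'⟩
    · rintro ⟨z, hxz, hz⟩
      have hx : x ≠ j := by
        rintro rfl
        exact hW'j (hsingle _ hxz ▸ hz)
      obtain ⟨z', hzz', hz'⟩ := hW'W z hz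
      have hz'j : z' ≠ Sum.inr j := by rintro rfl; exact hWj hz'
      refine ⟨hx, z', ?_, hz'⟩
      rw [hpull, if_neg (by simpa using hx), if_neg hz'j]
      exact hρ.trans hxz hzz'

end PatternOf

/-! ### The local relations at a bridge site -/

section Bridge

variable {c : ℤ} {P : ColPattern m} {E : Fin (m + 1) → Fin (m + 1) → Bool} {uL uR j : Fin (m + 1)}

/-- With no edge at `j`, the new site `inr j` is isolated in the update relation. [folklore] -/
theorem updRel_isolated_of_noEdge (hE : ∀ i, E i j = false) (P : ColPattern m)
    (y : Fin (m + 1) ⊕ Fin (m + 1)) : ¬ updRel m P E (Sum.inr j) y ∧ ¬ updRel m P E y (Sum.inr j) := by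
  rcases y with i | j' <;> simp [updRel, hE]

/-- The update relation of the bridge layer: the base relation plus the open bridge edges. [folklore] -/
theorem eqvGen_updRel_bridgeEdges_iff (hB : IsBridgeSite E uL uR j) (P : ColPattern m) (bL bR : Bool)
    (x y : Fin (m + 1) ⊕ Fin (m + 1)) :
    EqvGen (updRel m P (bridgeSiteEdges E uL uR j bL bR)) x y ↔
      EqvGen (fun x y => (updRel m P E x y ∨ (bL = true ∧ x = Sum.inl uL ∧ y = Sum.inr j)) ∨
        (bR = true ∧ x = Sum.inl uR ∧ y = Sum.inr j)) x y := by
  refine eqvGen_iff_eqvGen (fun x y h => ?_) (fun x y h => ?_) x y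
  · rcases x with i | j₁ <;> rcases y with i' | j₂
    · exact EqvGen.rel _ _ (Or.inl (Or.inl h))
    · simp only [updRel] at h
      rcases (bridgeEdges_apply hB bL bR i j₂).1 h with ⟨-, h⟩ | ⟨rfl, rfl, hb⟩ | ⟨rfl, rfl, hb⟩
      · exact EqvGen.rel _ _ (Or.inl (Or.inl h))
      · exact EqvGen.rel _ _ (Or.inl (Or.inr ⟨hb, rfl, rfl⟩))
      · exact EqvGen.rel _ _ (Or.inr ⟨hb, rfl, rfl⟩)
    · simp only [updRel] at h
      rcases (bridgeEdges_apply hB bL bR i' j₁).1 h with ⟨-, h⟩ | ⟨rfl, rfl, hb⟩ | ⟨rfl, rfl, hb⟩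
      · exact EqvGen.rel _ _ (Or.inl (Or.inl (show updRel m P E _ _ from h)))
      · exact EqvGen.symm _ _ (EqvGen.rel _ _ (Or.inl (Or.inr ⟨hb, rfl, rfl⟩)))
      · exact EqvGen.symm _ _ (EqvGen.rel _ _ (Or.inr ⟨hb, rfl, rfl⟩))
    · exact absurd h id
  · rcases h with (h | ⟨hb, rfl, rfl⟩) | ⟨hb, rfl, rfl⟩
    · refine EqvGen.rel _ _ ?_
      rcases x with i | j₁ <;> rcases y with i' | j₂ <;> simp only [updRel] at h ⊢
      · exact h
      · exact (bridgeEdges_apply hB bL bR i j₂).2 (Or.inl ⟨fun h' => by subst h'; simp [hB.noEdge] at h, h⟩)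
      · exact (bridgeEdges_apply hB bL bR i' j₁).2 (Or.inl ⟨fun h' => by subst h'; simp [hB.noEdge] at h, h⟩)
    · exact EqvGen.rel _ _ (show updRel m P _ _ _ from (bridgeEdges_apply hB bL bR uL j).2
        (Or.inr (Or.inl ⟨rfl, rfl, hb⟩)))
    · exact EqvGen.rel _ _ (show updRel m P _ _ _ from (bridgeEdges_apply hB bL bR uR j).2
        (Or.inr (Or.inr ⟨rfl, rfl, hb⟩)))

/-- The update relation of a joined pattern: the base relation plus the pair `(uL, uR)`. [folklore] -/
theorem eqvGen_updRel_cpJoin_iff {P : ColPattern m} (hP : ∀ i, P.1 i i = true)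
    (E' : Fin (m + 1) → Fin (m + 1) → Bool) (uL uR : Fin (m + 1)) (x y : Fin (m + 1) ⊕ Fin (m + 1)) :
    EqvGen (updRel m (cpJoin uL uR P) E') x y ↔
      EqvGen (fun x y => updRel m P E' x y ∨ (x = Sum.inl uL ∧ y = Sum.inl uR)) x y := by
  refine eqvGen_iff_eqvGen (fun x y h => ?_) (fun x y h => ?_) x y
  · rcases x with i | j₁ <;> rcases y with i' | j₂ <;> simp only [updRel] at h
    · rw [cpJoin_fst_eq_true_iff] at h
      have base : ∀ a b : Fin (m + 1), P.1 a b = true →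
          EqvGen (fun x y => updRel m P E' x y ∨ (x = Sum.inl uL ∧ y = Sum.inl uR)) (Sum.inl a) (Sum.inl b) :=
        fun a b h => EqvGen.rel _ _ (Or.inl h)
      have hLR : EqvGen (fun x y => updRel m P E' x y ∨ (x = Sum.inl uL ∧ y = Sum.inl uR))
          (Sum.inl uL) (Sum.inl uR) := EqvGen.rel _ _ (Or.inr ⟨rfl, rfl⟩)
      rcases h with h | ⟨h1, h2⟩ | ⟨h1, h2⟩
      · exact base _ _ h
      · exact EqvGen.trans _ _ _ (base _ _ h1) (EqvGen.trans _ _ _ hLR (base _ _ h2))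
      · exact EqvGen.trans _ _ _ (base _ _ h1) (EqvGen.trans _ _ _ (EqvGen.symm _ _ hLR) (base _ _ h2))
    · exact EqvGen.rel _ _ (Or.inl h)
    · exact EqvGen.rel _ _ (Or.inl (show updRel m P E' _ _ from h))
  · rcases h with h | ⟨rfl, rfl⟩
    · refine EqvGen.rel _ _ ?_
      rcases x with i | j₁ <;> rcases y with i' | j₂ <;> simp only [updRel] at h ⊢
      · rw [cpJoin_fst_eq_true_iff]; exact Or.inl h
      · exact h
      · exact h
    · refine EqvGen.rel _ _ ?_
      simp only [updRel]
      rw [cpJoin_fst_eq_true_iff]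
      exact Or.inr (Or.inl ⟨hP uL, hP uR⟩)

/-- More open edges generate more. [folklore] -/
theorem updRel_mono_edges {E₁ E₂ : Fin (m + 1) → Fin (m + 1) → Bool}
    (h : ∀ i j, E₁ i j = true → E₂ i j = true) (P : ColPattern m) (x y : Fin (m + 1) ⊕ Fin (m + 1))
    (hxy : updRel m P E₁ x y) : updRel m P E₂ x y := by
  rcases x with i | j₁ <;> rcases y with i' | j₂ <;> simp only [updRel] at hxy ⊢
  · exact hxy
  · exact h _ _ hxy
  · exact h _ _ hxy

/-- In the fully open bridge closure the two old neighbours are related (through `j`). [folklore] -/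
theorem eqvGen_bridge_open_open_LR (hB : IsBridgeSite E uL uR j) (P : ColPattern m) :
    EqvGen (updRel m P (bridgeSiteEdges E uL uR j true true)) (Sum.inl uL) (Sum.inl uR) := by
  have h1 : updRel m P (bridgeSiteEdges E uL uR j true true) (Sum.inl uL) (Sum.inr j) :=
    (bridgeEdges_apply hB true true uL j).2 (Or.inr (Or.inl ⟨rfl, rfl, rfl⟩))
  have h2 : updRel m P (bridgeSiteEdges E uL uR j true true) (Sum.inl uR) (Sum.inr j) :=
    (bridgeEdges_apply hB true true uR j).2 (Or.inr (Or.inr ⟨rfl, rfl, rfl⟩))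
  exact EqvGen.trans _ _ _ (EqvGen.rel _ _ h1) (EqvGen.symm _ _ (EqvGen.rel _ _ h2))

/-- **`M_ε ∘ join = M_oo`**: pre-joining the two old neighbours and opening at least one bridge edge
updates like opening both. [cite: IkhlefPonsaing2012, Lemma 3.2] -/
theorem colUpdate_cpJoin_bridge (hB : IsBridgeSite E uL uR j) (hP : ∀ i, P.1 i i = true) (bL bR : Bool)
    (hb : bL = true ∨ bR = true) :
    colUpdate m c (cpJoin uL uR P) (bridgeSiteEdges E uL uR j bL bR) =
      colUpdate m c P (bridgeSiteEdges E uL uR j true true) := by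
  have hLR := eqvGen_bridge_open_open_LR hB P
  -- the pair (uL, uR) is a generator on the joined side
  have hpair : updRel m (cpJoin uL uR P) (bridgeSiteEdges E uL uR j bL bR) (Sum.inl uL) (Sum.inl uR) := by
    simp only [updRel]; rw [cpJoin_fst_eq_true_iff]; exact Or.inr (Or.inl ⟨hP uL, hP uR⟩)
  have hrel : ∀ x y, EqvGen (updRel m (cpJoin uL uR P) (bridgeSiteEdges E uL uR j bL bR)) x y ↔
      EqvGen (updRel m P (bridgeSiteEdges E uL uR j true true)) x y := by
    refine eqvGen_iff_eqvGen (fun x y h => ?_) (fun x y h => ?_)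
    · rcases x with i | j₁ <;> rcases y with i' | j₂ <;> simp only [updRel] at h
      · rw [cpJoin_fst_eq_true_iff] at h
        have base : ∀ a b : Fin (m + 1), P.1 a b = true →
            EqvGen (updRel m P (bridgeSiteEdges E uL uR j true true)) (Sum.inl a) (Sum.inl b) :=
          fun a b h => EqvGen.rel _ _ h
        rcases h with h | ⟨h1, h2⟩ | ⟨h1, h2⟩
        · exact base _ _ h
        · exact EqvGen.trans _ _ _ (base _ _ h1) (EqvGen.trans _ _ _ hLR (base _ _ h2))
        · exact EqvGen.trans _ _ _ (base _ _ h1) (EqvGen.trans _ _ _ (EqvGen.symm _ _ hLR) (base _ _ h2))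
      · refine EqvGen.rel _ _ (show updRel m P _ _ _ from (bridgeEdges_apply hB true true i j₂).2 ?_)
        rcases (bridgeEdges_apply hB bL bR i j₂).1 h with h | ⟨h1, h2, -⟩ | ⟨h1, h2, -⟩
        · exact Or.inl h
        · exact Or.inr (Or.inl ⟨h1, h2, rfl⟩)
        · exact Or.inr (Or.inr ⟨h1, h2, rfl⟩)
      · refine EqvGen.rel _ _ (show updRel m P _ _ _ from (bridgeEdges_apply hB true true i' j₁).2 ?_)
        rcases (bridgeEdges_apply hB bL bR i' j₁).1 h with h | ⟨h1, h2, -⟩ | ⟨h1, h2, -⟩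
        · exact Or.inl h
        · exact Or.inr (Or.inl ⟨h1, h2, rfl⟩)
        · exact Or.inr (Or.inr ⟨h1, h2, rfl⟩)
    · -- generators of the fully open side inside the joined closure
      have hpair' := EqvGen.rel _ _ hpair
      have key : ∀ (i j' : Fin (m + 1)), bridgeSiteEdges E uL uR j true true i j' = true →
          EqvGen (updRel m (cpJoin uL uR P) (bridgeSiteEdges E uL uR j bL bR)) (Sum.inl i) (Sum.inr j') := by
        intro i j' h
        rcases (bridgeEdges_apply hB true true i j').1 h with ⟨h1, h2⟩ | ⟨hi, hj, -⟩ | ⟨hi, hj, -⟩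
        · exact EqvGen.rel _ _ (show updRel m _ _ _ _ from
            (bridgeEdges_apply hB bL bR i j').2 (Or.inl ⟨h1, h2⟩))
        · rw [hi, hj]
          rcases hb with hb | hb
          · exact EqvGen.rel _ _ (show updRel m _ _ _ _ from
              (bridgeEdges_apply hB bL bR uL j).2 (Or.inr (Or.inl ⟨rfl, rfl, hb⟩)))
          · exact EqvGen.trans _ _ _ hpair' (EqvGen.rel _ _ (show updRel m _ _ _ _ from
              (bridgeEdges_apply hB bL bR uR j).2 (Or.inr (Or.inr ⟨rfl, rfl, hb⟩))))
        · rw [hi, hj]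
          rcases hb with hb | hb
          · exact EqvGen.trans _ _ _ (EqvGen.symm _ _ hpair') (EqvGen.rel _ _ (show updRel m _ _ _ _ from
              (bridgeEdges_apply hB bL bR uL j).2 (Or.inr (Or.inl ⟨rfl, rfl, hb⟩))))
          · exact EqvGen.rel _ _ (show updRel m _ _ _ _ from
              (bridgeEdges_apply hB bL bR uR j).2 (Or.inr (Or.inr ⟨rfl, rfl, hb⟩)))
      rcases x with i | j₁ <;> rcases y with i' | j₂ <;> simp only [updRel] at h
      · exact EqvGen.rel _ _ (show updRel m _ _ _ _ by
          simp only [updRel]; rw [cpJoin_fst_eq_true_iff]; exact Or.inl h)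
      · exact key i j₂ h
      · exact EqvGen.symm _ _ (key i' j₁ h)
  refine colUpdate_ext hrel (fun z hz => ?_) (fun z hz => ⟨z, EqvGen.refl _, ?_⟩)
  · rcases z with i | j'
    · simp only [updWall] at hz ⊢
      rw [cpJoin_snd_eq_true_iff] at hz
      rcases hz with hz | ⟨h1, h2⟩ | ⟨h1, h2⟩
      · exact ⟨Sum.inl i, EqvGen.refl _, hz⟩
      · exact ⟨Sum.inl uR, EqvGen.trans _ _ _ (EqvGen.rel (Sum.inl i) (Sum.inl uL) h1) hLR, h2⟩
      · exact ⟨Sum.inl uL, EqvGen.trans _ _ _ (EqvGen.rel (Sum.inl i) (Sum.inl uR) h1) (EqvGen.symm _ _ hLR), h2⟩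
    · exact ⟨Sum.inr j', EqvGen.refl _, hz⟩
  · rcases z with i | j'
    · simp only [updWall] at hz ⊢
      rw [cpJoin_snd_eq_true_iff]; exact Or.inl hz
    · exact hz

/-- **`iso_j ∘ M_oo = M_cc ∘ join`**: opening both bridge edges and then isolating the bridge site
updates like closing both after joining the two old neighbours. [cite: IkhlefPonsaing2012, Lemma 3.2] -/
theorem cpIsolate_colUpdate_bridge_open_open (hB : IsBridgeSite E uL uR j) (hP : ∀ i, P.1 i i = true)
    (hWj : ¬ ((c + 1) % 2 = 0 ∧ (j : ℕ) = 0)) :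
    cpIsolate j (colUpdate m c P (bridgeSiteEdges E uL uR j true true)) = colUpdate m c (cpJoin uL uR P) E := by
  classical
  rw [colUpdate_eq_patternOf, colUpdate_eq_patternOf]
  set s := updRel m (cpJoin uL uR P) E with hs
  have hjs : ∀ y, ¬ s (Sum.inr j) y ∧ ¬ s y (Sum.inr j) := updRel_isolated_of_noEdge hB.noEdge _
  have hρ : Equivalence (EqvGen s) := EqvGen.is_equivalence s
  have hpairs : s (Sum.inl uL) (Sum.inl uR) := by
    simp only [hs, updRel]; rw [cpJoin_fst_eq_true_iff]; exact Or.inr (Or.inl ⟨hP uL, hP uR⟩)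
  -- the fully open closure is `s` plus the pair (uL, j)
  have hgen : ∀ x y, EqvGen (updRel m P (bridgeSiteEdges E uL uR j true true)) x y ↔
      EqvGen (fun x y => s x y ∨ (x = Sum.inl uL ∧ y = Sum.inr j)) x y := by
    have hLR := eqvGen_bridge_open_open_LR hB P
    refine eqvGen_iff_eqvGen (fun x y h => ?_) (fun x y h => ?_)
    · rcases x with i | j₁ <;> rcases y with i' | j₂ <;> simp only [updRel] at h
      · exact EqvGen.rel _ _ (Or.inl (show s _ _ by
          simp only [hs, updRel]; rw [cpJoin_fst_eq_true_iff]; exact Or.inl h))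
      · rcases (bridgeEdges_apply hB true true i j₂).1 h with ⟨-, h2⟩ | ⟨rfl, rfl, -⟩ | ⟨rfl, rfl, -⟩
        · exact EqvGen.rel _ _ (Or.inl (show s _ _ from h2))
        · exact EqvGen.rel _ _ (Or.inr ⟨rfl, rfl⟩)
        · exact EqvGen.trans _ _ _ (EqvGen.symm _ _ (EqvGen.rel _ _ (Or.inl hpairs)))
            (EqvGen.rel _ _ (Or.inr ⟨rfl, rfl⟩))
      · rcases (bridgeEdges_apply hB true true i' j₁).1 h with ⟨-, h2⟩ | ⟨rfl, rfl, -⟩ | ⟨rfl, rfl, -⟩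
        · exact EqvGen.rel _ _ (Or.inl (show s _ _ from h2))
        · exact EqvGen.symm _ _ (EqvGen.rel _ _ (Or.inr ⟨rfl, rfl⟩))
        · exact EqvGen.symm _ _ (EqvGen.trans _ _ _ (EqvGen.symm _ _ (EqvGen.rel _ _ (Or.inl hpairs)))
            (EqvGen.rel _ _ (Or.inr ⟨rfl, rfl⟩)))
    · rcases h with h | ⟨rfl, rfl⟩
      · rcases x with i | j₁ <;> rcases y with i' | j₂ <;> simp only [hs, updRel] at h
        · rw [cpJoin_fst_eq_true_iff] at h
          have base : ∀ a b : Fin (m + 1), P.1 a b = true →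
              EqvGen (updRel m P (bridgeSiteEdges E uL uR j true true)) (Sum.inl a) (Sum.inl b) :=
            fun a b h => EqvGen.rel _ _ h
          rcases h with h | ⟨h1, h2⟩ | ⟨h1, h2⟩
          · exact base _ _ h
          · exact EqvGen.trans _ _ _ (base _ _ h1) (EqvGen.trans _ _ _ hLR (base _ _ h2))
          · exact EqvGen.trans _ _ _ (base _ _ h1) (EqvGen.trans _ _ _ (EqvGen.symm _ _ hLR) (base _ _ h2))
        · exact EqvGen.rel _ _ (show updRel m P _ _ _ from
            (bridgeEdges_apply hB true true i j₂).2 (Or.inl ⟨fun h' => by subst h'; simp [hB.noEdge] at h, h⟩))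
        · exact EqvGen.rel _ _ (show updRel m P _ _ _ from
            (bridgeEdges_apply hB true true i' j₁).2 (Or.inl ⟨fun h' => by subst h'; simp [hB.noEdge] at h, h⟩))
      · exact EqvGen.rel _ _ (show updRel m P _ _ _ from
          (bridgeEdges_apply hB true true uL j).2 (Or.inr (Or.inl ⟨rfl, rfl, rfl⟩)))
  refine cpIsolate_patternOf_pullback (t := Sum.inl uL) hρ (fun x y => ?_) (fun y hy => ?_) hWj ?_ ?_ ?_
  · rw [hgen, eqvGen_attach_isolated (Sum.inl uL) hjs]
  · exact (eqvGen_isolated_iff hjs y).1 hy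
  · simpa [updWall] using hWj
  · intro z hz
    refine ⟨z, EqvGen.refl _, ?_⟩
    rcases z with i | j'
    · simp only [updWall] at hz ⊢; rw [cpJoin_snd_eq_true_iff]; exact Or.inl hz
    · exact hz
  · intro z hz
    rcases z with i | j'
    · simp only [updWall] at hz ⊢
      rw [cpJoin_snd_eq_true_iff] at hz
      rcases hz with hz | ⟨h1, h2⟩ | ⟨h1, h2⟩
      · exact ⟨Sum.inl i, EqvGen.refl _, hz⟩
      · refine ⟨Sum.inl uR, EqvGen.trans _ _ _ (EqvGen.rel _ _ ?_) (EqvGen.rel _ _ hpairs), h2⟩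
        simp only [hs, updRel]; rw [cpJoin_fst_eq_true_iff]; exact Or.inl h1
      · refine ⟨Sum.inl uL, EqvGen.trans _ _ _ (EqvGen.rel _ _ ?_) (EqvGen.symm _ _ (EqvGen.rel _ _ hpairs)), h2⟩
        simp only [hs, updRel]; rw [cpJoin_fst_eq_true_iff]; exact Or.inl h1
    · exact ⟨Sum.inr j', EqvGen.refl _, hz⟩

/-- **`iso_j ∘ M_ε = M_cc`** for `ε ≠ oo`: with at most one bridge edge open, isolating the bridge site
afterwards updates like closing both. [cite: IkhlefPonsaing2012, Lemma 3.2] -/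
theorem cpIsolate_colUpdate_bridge_not_both (hB : IsBridgeSite E uL uR j)
    (hWj : ¬ ((c + 1) % 2 = 0 ∧ (j : ℕ) = 0)) (bL bR : Bool) (hb : ¬ (bL = true ∧ bR = true)) :
    cpIsolate j (colUpdate m c P (bridgeSiteEdges E uL uR j bL bR)) = colUpdate m c P E := by
  classical
  rw [colUpdate_eq_patternOf, colUpdate_eq_patternOf]
  set s := updRel m P E with hs
  have hjs : ∀ y, ¬ s (Sum.inr j) y ∧ ¬ s y (Sum.inr j) := updRel_isolated_of_noEdge hB.noEdge _
  have hρ : Equivalence (EqvGen s) := EqvGen.is_equivalence s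
  -- the attachment point
  set t : Fin (m + 1) ⊕ Fin (m + 1) :=
    if bL = true then Sum.inl uL else if bR = true then Sum.inl uR else Sum.inr j with ht
  have hgen : ∀ x y, EqvGen (updRel m P (bridgeSiteEdges E uL uR j bL bR)) x y ↔
      EqvGen (fun x y => s x y ∨ (x = t ∧ y = Sum.inr j)) x y := by
    refine eqvGen_iff_eqvGen (fun x y h => ?_) (fun x y h => ?_)
    · rcases x with i | j₁ <;> rcases y with i' | j₂ <;> simp only [updRel] at h
      · exact EqvGen.rel _ _ (Or.inl h)
      · rcases (bridgeEdges_apply hB bL bR i j₂).1 h with ⟨-, h2⟩ | ⟨rfl, rfl, hb'⟩ | ⟨rfl, rfl, hb'⟩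
        · exact EqvGen.rel _ _ (Or.inl (show s _ _ from h2))
        · exact EqvGen.rel _ _ (Or.inr ⟨by simp [ht, hb'], rfl⟩)
        · have : bL = false := by simpa [hb'] using hb
          exact EqvGen.rel _ _ (Or.inr ⟨by simp [ht, hb', this], rfl⟩)
      · rcases (bridgeEdges_apply hB bL bR i' j₁).1 h with ⟨-, h2⟩ | ⟨rfl, rfl, hb'⟩ | ⟨rfl, rfl, hb'⟩
        · exact EqvGen.rel _ _ (Or.inl (show s _ _ from h2))
        · exact EqvGen.symm _ _ (EqvGen.rel _ _ (Or.inr ⟨by simp [ht, hb'], rfl⟩))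
        · have : bL = false := by simpa [hb'] using hb
          exact EqvGen.symm _ _ (EqvGen.rel _ _ (Or.inr ⟨by simp [ht, hb', this], rfl⟩))
    · rcases h with h | ⟨rfl, rfl⟩
      · exact EqvGen.rel _ _ (updRel_mono_edges (fun i j' h => (bridgeEdges_apply hB bL bR i j').2
          (Or.inl ⟨fun h' => by subst h'; simp [hB.noEdge] at h, h⟩)) P x y h)
      · simp only [ht]
        split_ifs with h1 h2
        · exact EqvGen.rel _ _ (show updRel m P _ _ _ from
            (bridgeEdges_apply hB bL bR uL j).2 (Or.inr (Or.inl ⟨rfl, rfl, h1⟩)))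
        · exact EqvGen.rel _ _ (show updRel m P _ _ _ from
            (bridgeEdges_apply hB bL bR uR j).2 (Or.inr (Or.inr ⟨rfl, rfl, h2⟩)))
        · exact EqvGen.refl _
  refine cpIsolate_patternOf_pullback (t := t) hρ (fun x y => ?_) (fun y hy => ?_) hWj hWj
    (fun z hz => ⟨z, EqvGen.refl _, hz⟩) (fun z hz => ⟨z, EqvGen.refl _, hz⟩)
  · rw [hgen, eqvGen_attach_isolated t hjs]
  · exact (eqvGen_isolated_iff hjs y).1 hy

/-- The all-closed bridge layer is the layer itself. [folklore] -/
theorem bridgeEdges_false_false (hB : IsBridgeSite E uL uR j) : bridgeSiteEdges E uL uR j false false = E := by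
  funext i j'
  rw [Bool.eq_iff_iff, bridgeEdges_apply hB]
  simp only [Bool.false_eq_true, and_false, or_false]
  constructor
  · rintro ⟨-, h⟩; exact h
  · intro h
    refine ⟨?_, h⟩
    rintro rfl
    simp [hB.noEdge] at h

end Bridge

end Literature.Probability.Percolation
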